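import Summits.ValiantsHypothesis.ValiantsHypothesis.Theorems.BarrierLeverAnchoredDoorHitsLowerPairsStarCalc
import Summits.ValiantsHypothesis.ValiantsHypothesis.Theorems.BarrierLeverAnchoredDoorHitsLowerPairsCrossed

/-!
# Route BarrierLever — support item `AnchoredDoorHitsLowerPairs` (stmt-ValiantsHypothesis-22510), line `anchored_peeling`:
# THE PRODUCT DOOR IS A MEMBER OF 𝔄₂, part 1: the star point, the star factors of `W₂`, the three live anchor families

The STAR POINT of the profile-2 parameter space (from complex edge weights `g`, `dd`): vertex anchors `({a},{d})` get weight `g a d + dd a d`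
and no tails; anchors `({b,a},{d})` (`b < a`) get weight `g b d · g a d` and the ordered `x`-tail `g b' d` at the EARLIER vertices `b' < b`;
anchors `({a},{e,d})` (`e < d`) get weight `dd a e · dd a d` and `y`-tail `dd a e'` at `e' < e`; anchors of profile `(2,2)` get weight `0`.
At this point the anchored witness `W₂` satisfies, modulo squares of variables (`StarDoor.SqEq`),
`(∏_a (1+x_a)) (∏_d (1+y_d)) · W₂ ≡ Π(g,dd) = ∏_d (1 + y_d ∏_b (1 + g_{bd} x_b)) · ∏_a (1 + x_a ∏_e (1 + dd_{ae} y_e))`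
(root-factor splitting `…StarCalc.root_factor_split` + linearisation + telescoping `Finset.prod_one_add_ordered`), whence for injective LOWER
families the star-forest block is `Zᵀ · (layout of W₂) · Z` with the zeta matrices of the two families, and a nonsingular star-forest block forces
`symbolicDet 2 ≠ 0`. CONSEQUENCE: `anchoredDoorHitsLowerPairs_of_conjStarLower : Stmt.conjStarLower → AnchoredDoorHitsLowerPairs` (item BY NAME,
`s = 2`, `h₀ = 0`), and the same from `Stmt.conjStarTN`. Nothing here bears on crux 14610 or `VP ≠ VNP`.
-/

set_option linter.dupNamespace false

namespace Summit.ValiantsHypothesis.ValiantsHypothesis.Theorems.BarrierLever.AnchoredPeeling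

open Finset MvPolynomial
open Summit.ValiantsHypothesis.ValiantsHypothesis.Theorems.BarrierLever.BrickCalculus (pexpo pexpo_def pexpo_le_iff pexpo_sub
  pexpo_apply_castAdd pexpo_apply_natAdd)

noncomputable section

namespace StarDoor

variable {h : ℕ}

/-! ## 1. The star point of the profile-2 parameter space -/

/-- The star point: values of `θ`, `φ`, `ψ` on the anchors of 𝔄₂ (see the module docstring). -/
def starPoint (g dd : Fin h → Fin h → ℂ) : Param h → ℂ
  | Sum.inl α =>
      if α.1.card = 1 ∧ α.2.card = 1 then ∑ a ∈ α.1, ∑ d ∈ α.2, (g a d + dd a d)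
      else if α.1.card = 2 ∧ α.2.card = 1 then ∑ d ∈ α.2, ∏ a ∈ α.1, g a d
      else if α.1.card = 1 ∧ α.2.card = 2 then ∑ a ∈ α.1, ∏ d ∈ α.2, dd a d
      else 0
  | Sum.inr (Sum.inl (α, b)) =>
      if α.1.card = 2 ∧ α.2.card = 1 ∧ (∀ c ∈ α.1, b < c) then ∑ d ∈ α.2, g b d else 0
  | Sum.inr (Sum.inr (α, e)) =>
      if α.1.card = 1 ∧ α.2.card = 2 ∧ (∀ c ∈ α.2, e < c) then ∑ a ∈ α.1, dd a e else 0

/-- The profile-2 witness at the star point. -/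
def W2 (g dd : Fin h → Fin h → ℂ) : MvPolynomial (Fin (h + h)) ℂ :=
  MvPolynomial.map (MvPolynomial.eval (starPoint g dd)) (symbolicWitness 2 h)

/-- The image of one door factor under evaluation at a parameter point. -/
theorem map_eval_symbFactor (p : Param h → ℂ) (α : Finset (Fin h) × Finset (Fin h)) :
    MvPolynomial.map (MvPolynomial.eval p) (symbFactor h α) =
      1 + C (p (Sum.inl α)) * (∏ a ∈ α.1, xv a) * (∏ c ∈ α.2, yv c) *
        (∏ b ∈ univ \ α.1, (1 + C (p (Sum.inr (Sum.inl (α, b)))) * xv b)) *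
        (∏ d ∈ univ \ α.2, (1 + C (p (Sum.inr (Sum.inr (α, d)))) * yv d)) := by
  simp only [symbFactor, map_add, map_one, map_mul, map_prod, map_C, map_X, eval_X, xv, yv]

/-- The factor of the star witness at the anchor `α`. -/
def starFactor (g dd : Fin h → Fin h → ℂ) (α : Finset (Fin h) × Finset (Fin h)) : MvPolynomial (Fin (h + h)) ℂ :=
  MvPolynomial.map (MvPolynomial.eval (starPoint g dd)) (symbFactor h α)

/-- The evaluated witness `W₂` is the product of the star factors over all profile-2 anchors. -/
theorem W2_eq_prod (g dd : Fin h → Fin h → ℂ) : W2 g dd = ∏ α ∈ anchors 2 h, starFactor g dd α := by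
  rw [W2, symbolicWitness_eq_prod, map_prod]; rfl

/-- The `(1,1)` vertex factor: `1 + (g_{ad} + dd_{ad}) x_a y_d`. -/
theorem starFactor_vtx (g dd : Fin h → Fin h → ℂ) (a d : Fin h) :
    starFactor g dd (({a}, {d}) : Finset (Fin h) × Finset (Fin h)) = 1 + C (g a d + dd a d) * xv a * yv d := by
  rw [starFactor, map_eval_symbFactor]
  have h1 : starPoint g dd (Sum.inl (({a}, {d}) : Finset (Fin h) × Finset (Fin h))) = g a d + dd a d := by
    simp [starPoint]
  have h2 : ∀ b : Fin h, starPoint g dd (Sum.inr (Sum.inl ((({a}, {d}) : Finset (Fin h) × Finset (Fin h)), b))) = 0 := by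
    intro b; simp [starPoint]
  have h3 : ∀ e : Fin h, starPoint g dd (Sum.inr (Sum.inr ((({a}, {d}) : Finset (Fin h) × Finset (Fin h)), e))) = 0 := by
    intro e; simp [starPoint]
  simp only [h1, h2, h3, C_0, zero_mul, add_zero, Finset.prod_const_one, mul_one, Finset.prod_singleton]

/-- The `(2,1)` factor at `({b,a},{d})`, `b < a`: `1 + g_{bd} g_{ad} x_b x_a y_d ∏_{b'<b} (1 + g_{b'd} x_{b'})`. -/
theorem starFactor_pair_left (g dd : Fin h → Fin h → ℂ) {b a : Fin h} (hba : b < a) (d : Fin h) :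
    starFactor g dd (({b, a}, {d}) : Finset (Fin h) × Finset (Fin h)) =
      1 + (C (g a d) * xv a * yv d) * ((C (g b d) * xv b) * ∏ b' ∈ Finset.Iio b, (1 + C (g b' d) * xv b')) := by
  classical
  have hne : b ≠ a := ne_of_lt hba
  rw [starFactor, map_eval_symbFactor]
  have hcard : (({b, a} : Finset (Fin h)).card = 2) := Finset.card_pair hne
  have h1 : starPoint g dd (Sum.inl (({b, a}, {d}) : Finset (Fin h) × Finset (Fin h))) = g b d * g a d := by
    simp [starPoint, hcard, Finset.prod_pair hne]
  have h2 : ∀ b' : Fin h, starPoint g dd (Sum.inr (Sum.inl ((({b, a}, {d}) : Finset (Fin h) × Finset (Fin h)), b'))) =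
      if b' < b then g b' d else 0 := by
    intro b'
    simp only [starPoint, hcard, Finset.card_singleton, Finset.mem_insert, Finset.mem_singleton, forall_eq_or_imp, forall_eq,
      Finset.sum_singleton, true_and]
    by_cases hb' : b' < b
    · rw [if_pos ⟨hb', lt_trans hb' hba⟩, if_pos hb']
    · rw [if_neg (fun hh => hb' hh.1), if_neg hb']
  have h3 : ∀ e : Fin h, starPoint g dd (Sum.inr (Sum.inr ((({b, a}, {d}) : Finset (Fin h) × Finset (Fin h)), e))) = 0 := by
    intro e; simp [starPoint, hcard]
  simp only [h1, h2, h3, C_0, zero_mul, add_zero, Finset.prod_const_one, mul_one, Finset.prod_singleton, Finset.prod_pair hne]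
  -- the tail product: factors with ¬ b' < b are 1, the rest is over `Iio b`
  have htail : ∏ b' ∈ univ \ ({b, a} : Finset (Fin h)), (1 + C (if b' < b then g b' d else 0) * xv b') =
      ∏ b' ∈ Finset.Iio b, (1 + C (g b' d) * xv b') := by
    have hite : ∀ b' : Fin h, (1 + C (if b' < b then g b' d else 0) * xv b' : MvPolynomial (Fin (h + h)) ℂ) =
        if b' < b then 1 + C (g b' d) * xv b' else 1 := by
      intro b'; split_ifs <;> simp
    simp_rw [hite]
    rw [Finset.prod_ite, Finset.prod_const_one, mul_one]
    apply Finset.prod_congr _ (fun _ _ => rfl)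
    ext b'
    simp only [Finset.mem_filter, Finset.mem_sdiff, Finset.mem_univ, Finset.mem_insert, Finset.mem_singleton, true_and, Finset.mem_Iio]
    constructor
    · exact fun hh => hh.2
    · intro hb'
      exact ⟨fun hh => by rcases hh with rfl | rfl <;> [exact lt_irrefl _ hb'; exact lt_asymm hba hb'], hb'⟩
  rw [htail, map_mul]
  ring

/-- The `(1,2)` factor at `({a},{e,d})`, `e < d`: `1 + dd_{ae} dd_{ad} x_a y_e y_d ∏_{e'<e} (1 + dd_{ae'} y_{e'})`. -/
theorem starFactor_pair_right (g dd : Fin h → Fin h → ℂ) (a : Fin h) {e d : Fin h} (hed : e < d) :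
    starFactor g dd (({a}, {e, d}) : Finset (Fin h) × Finset (Fin h)) =
      1 + (C (dd a d) * xv a * yv d) * ((C (dd a e) * yv e) * ∏ e' ∈ Finset.Iio e, (1 + C (dd a e') * yv e')) := by
  classical
  have hne : e ≠ d := ne_of_lt hed
  rw [starFactor, map_eval_symbFactor]
  have hcard : (({e, d} : Finset (Fin h)).card = 2) := Finset.card_pair hne
  have h1 : starPoint g dd (Sum.inl (({a}, {e, d}) : Finset (Fin h) × Finset (Fin h))) = dd a e * dd a d := by
    simp [starPoint, hcard, Finset.prod_pair hne]
  have h2 : ∀ b' : Fin h, starPoint g dd (Sum.inr (Sum.inl ((({a}, {e, d}) : Finset (Fin h) × Finset (Fin h)), b'))) = 0 := by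
    intro b'; simp [starPoint, hcard]
  have h3 : ∀ e' : Fin h, starPoint g dd (Sum.inr (Sum.inr ((({a}, {e, d}) : Finset (Fin h) × Finset (Fin h)), e'))) =
      if e' < e then dd a e' else 0 := by
    intro e'
    simp only [starPoint, hcard, Finset.card_singleton, Finset.mem_insert, Finset.mem_singleton, forall_eq_or_imp, forall_eq,
      Finset.sum_singleton, true_and]
    by_cases he' : e' < e
    · rw [if_pos ⟨he', lt_trans he' hed⟩, if_pos he']
    · rw [if_neg (fun hh => he' hh.1), if_neg he']
  simp only [h1, h2, h3, C_0, zero_mul, add_zero, Finset.prod_const_one, mul_one, Finset.prod_singleton, Finset.prod_pair hne]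
  have htail : ∏ e' ∈ univ \ ({e, d} : Finset (Fin h)), (1 + C (if e' < e then dd a e' else 0) * yv e') =
      ∏ e' ∈ Finset.Iio e, (1 + C (dd a e') * yv e') := by
    have hite : ∀ e' : Fin h, (1 + C (if e' < e then dd a e' else 0) * yv e' : MvPolynomial (Fin (h + h)) ℂ) =
        if e' < e then 1 + C (dd a e') * yv e' else 1 := by
      intro e'; split_ifs <;> simp
    simp_rw [hite]
    rw [Finset.prod_ite, Finset.prod_const_one, mul_one]
    apply Finset.prod_congr _ (fun _ _ => rfl)
    ext e'
    simp only [Finset.mem_filter, Finset.mem_sdiff, Finset.mem_univ, Finset.mem_insert, Finset.mem_singleton, true_and, Finset.mem_Iio]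
    constructor
    · exact fun hh => hh.2
    · intro he'
      exact ⟨fun hh => by rcases hh with rfl | rfl <;> [exact lt_irrefl _ he'; exact lt_asymm hed he'], he'⟩
  rw [htail, map_mul]
  ring

/-- Anchors of 𝔄₂ of profile `(2,2)` (i.e. in none of the three images) have trivial factor at the star point. -/
theorem starFactor_eq_one_of_cards (g dd : Fin h → Fin h → ℂ) (α : Finset (Fin h) × Finset (Fin h))
    (h11 : ¬ (α.1.card = 1 ∧ α.2.card = 1)) (h21 : ¬ (α.1.card = 2 ∧ α.2.card = 1)) (h12 : ¬ (α.1.card = 1 ∧ α.2.card = 2)) :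
    starFactor g dd α = 1 := by
  rw [starFactor, map_eval_symbFactor]
  have h0 : starPoint g dd (Sum.inl α) = 0 := by
    simp only [starPoint, h11, h21, h12, if_false]
  rw [h0, C_0]
  simp

/-! ## 2. The three families of live anchors -/

/-- The `(2,1)` anchors as an image of ordered triples `(b < a, d)`. -/
def T21 (h : ℕ) : Finset (Finset (Fin h) × Finset (Fin h)) :=
  (Finset.univ.filter (fun q : (Fin h × Fin h) × Fin h => q.1.1 < q.1.2)).image
    (fun q => (({q.1.1, q.1.2} : Finset (Fin h)), ({q.2} : Finset (Fin h))))

/-- The `(1,2)` anchors as an image of ordered triples `(a, e < d)`. -/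
def T12 (h : ℕ) : Finset (Finset (Fin h) × Finset (Fin h)) :=
  (Finset.univ.filter (fun q : Fin h × (Fin h × Fin h) => q.2.1 < q.2.2)).image
    (fun q => (({q.1} : Finset (Fin h)), ({q.2.1, q.2.2} : Finset (Fin h))))

/-- The vertex anchors. -/
def T11 (h : ℕ) : Finset (Finset (Fin h) × Finset (Fin h)) := Finset.univ.image (vtx (h := h))

/-- Two increasing pairs with the same underlying two-element set coincide. -/
theorem pair_eq_pair_iff {b a b' a' : Fin h} (hba : b < a) (hba' : b' < a') (heq : ({b, a} : Finset (Fin h)) = {b', a'}) :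
    b = b' ∧ a = a' := by
  have hb : b ∈ ({b', a'} : Finset (Fin h)) := heq ▸ Finset.mem_insert_self b {a}
  have ha : a ∈ ({b', a'} : Finset (Fin h)) := heq ▸ Finset.mem_insert_of_mem (Finset.mem_singleton_self a)
  simp only [Finset.mem_insert, Finset.mem_singleton] at hb ha
  rcases hb with hb1 | hb1
  · rcases ha with h1 | h1
    · rw [h1, ← hb1] at hba; exact absurd hba (lt_irrefl _)
    · exact ⟨hb1, h1⟩
  · exfalso
    rcases ha with h1 | h1
    · rw [h1, hb1] at hba; exact absurd hba (lt_asymm hba')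
    · rw [h1, hb1] at hba; exact absurd hba (lt_irrefl _)

/-- The parametrisation of the `(2,1)` anchors by increasing pairs and a column vertex is injective. -/
theorem T21_injOn : Set.InjOn (fun q : (Fin h × Fin h) × Fin h => (({q.1.1, q.1.2} : Finset (Fin h)), ({q.2} : Finset (Fin h))))
    ↑(Finset.univ.filter (fun q : (Fin h × Fin h) × Fin h => q.1.1 < q.1.2)) := by
  intro q hq q' hq' hqq
  have hq1 : q.1.1 < q.1.2 := by simpa using hq
  have hq1' : q'.1.1 < q'.1.2 := by simpa using hq'
  simp only [Prod.mk.injEq, Finset.singleton_inj] at hqq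
  obtain ⟨h1, h2⟩ := pair_eq_pair_iff hq1 hq1' hqq.1
  exact Prod.ext (Prod.ext h1 h2) hqq.2

/-- The parametrisation of the `(1,2)` anchors by a row vertex and an increasing pair is injective. -/
theorem T12_injOn : Set.InjOn (fun q : Fin h × (Fin h × Fin h) => (({q.1} : Finset (Fin h)), ({q.2.1, q.2.2} : Finset (Fin h))))
    ↑(Finset.univ.filter (fun q : Fin h × (Fin h × Fin h) => q.2.1 < q.2.2)) := by
  intro q hq q' hq' hqq
  have hq1 : q.2.1 < q.2.2 := by simpa using hq
  have hq1' : q'.2.1 < q'.2.2 := by simpa using hq'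
  simp only [Prod.mk.injEq, Finset.singleton_inj] at hqq
  obtain ⟨h1, h2⟩ := pair_eq_pair_iff hq1 hq1' hqq.2
  exact Prod.ext hqq.1 (Prod.ext h1 h2)

/-- Members of `T11` have profile `(1,1)`. -/
theorem card_of_mem_T11 {α : Finset (Fin h) × Finset (Fin h)} (hα : α ∈ T11 h) : α.1.card = 1 ∧ α.2.card = 1 := by
  obtain ⟨p, -, rfl⟩ := Finset.mem_image.mp hα
  simp [vtx]

/-- Members of `T21` have profile `(2,1)`. -/
theorem card_of_mem_T21 {α : Finset (Fin h) × Finset (Fin h)} (hα : α ∈ T21 h) : α.1.card = 2 ∧ α.2.card = 1 := by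
  obtain ⟨q, hq, rfl⟩ := Finset.mem_image.mp hα
  have hq1 : q.1.1 < q.1.2 := (Finset.mem_filter.mp hq).2
  simp [Finset.card_pair (ne_of_lt hq1)]

/-- Members of `T12` have profile `(1,2)`. -/
theorem card_of_mem_T12 {α : Finset (Fin h) × Finset (Fin h)} (hα : α ∈ T12 h) : α.1.card = 1 ∧ α.2.card = 2 := by
  obtain ⟨q, hq, rfl⟩ := Finset.mem_image.mp hα
  have hq1 : q.2.1 < q.2.2 := (Finset.mem_filter.mp hq).2
  simp [Finset.card_pair (ne_of_lt hq1)]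

/-- An anchor of profile `(1,1)` lies in `T11`. -/
theorem mem_T11_of_cards {α : Finset (Fin h) × Finset (Fin h)} (h1 : α.1.card = 1) (h2 : α.2.card = 1) : α ∈ T11 h := by
  obtain ⟨a, ha⟩ := Finset.card_eq_one.mp h1
  obtain ⟨d, hd⟩ := Finset.card_eq_one.mp h2
  refine Finset.mem_image.mpr ⟨(a, d), Finset.mem_univ _, ?_⟩
  rw [vtx]; ext <;> simp [ha, hd]

/-- An anchor of profile `(2,1)` lies in `T21`. -/
theorem mem_T21_of_cards {α : Finset (Fin h) × Finset (Fin h)} (h1 : α.1.card = 2) (h2 : α.2.card = 1) : α ∈ T21 h := by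
  obtain ⟨x, y, hxy, hA⟩ := Finset.card_eq_two.mp h1
  obtain ⟨d, hd⟩ := Finset.card_eq_one.mp h2
  rcases lt_or_gt_of_ne hxy with hlt | hgt
  · refine Finset.mem_image.mpr ⟨((x, y), d), Finset.mem_filter.mpr ⟨Finset.mem_univ _, hlt⟩, ?_⟩
    ext <;> simp [hA, hd]
  · refine Finset.mem_image.mpr ⟨((y, x), d), Finset.mem_filter.mpr ⟨Finset.mem_univ _, hgt⟩, ?_⟩
    ext <;> simp [hA, hd, Finset.pair_comm]

/-- An anchor of profile `(1,2)` lies in `T12`. -/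
theorem mem_T12_of_cards {α : Finset (Fin h) × Finset (Fin h)} (h1 : α.1.card = 1) (h2 : α.2.card = 2) : α ∈ T12 h := by
  obtain ⟨a, ha⟩ := Finset.card_eq_one.mp h1
  obtain ⟨x, y, hxy, hB⟩ := Finset.card_eq_two.mp h2
  rcases lt_or_gt_of_ne hxy with hlt | hgt
  · refine Finset.mem_image.mpr ⟨(a, (x, y)), Finset.mem_filter.mpr ⟨Finset.mem_univ _, hlt⟩, ?_⟩
    ext <;> simp [ha, hB]
  · refine Finset.mem_image.mpr ⟨(a, (y, x)), Finset.mem_filter.mpr ⟨Finset.mem_univ _, hgt⟩, ?_⟩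
    ext <;> simp [ha, hB, Finset.pair_comm]

/-- **The star witness is the product of its three live families of factors.** -/
theorem W2_eq_three (g dd : Fin h → Fin h → ℂ) :
    W2 g dd = (∏ α ∈ T11 h, starFactor g dd α) * (∏ α ∈ T21 h, starFactor g dd α) * (∏ α ∈ T12 h, starFactor g dd α) := by
  classical
  rw [W2_eq_prod]
  have hd1 : Disjoint (T11 h) (T21 h) := by
    rw [Finset.disjoint_left]; intro α h1 h2
    have := (card_of_mem_T11 h1).1; have := (card_of_mem_T21 h2).1; omega
  have hd2 : Disjoint (T11 h ∪ T21 h) (T12 h) := by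
    rw [Finset.disjoint_left]; intro α h1 h2
    have h3 := (card_of_mem_T12 h2).2
    rcases Finset.mem_union.mp h1 with h1 | h1
    · have := (card_of_mem_T11 h1).2; omega
    · have := (card_of_mem_T21 h1).2; omega
  have hsub : T11 h ∪ T21 h ∪ T12 h ⊆ anchors 2 h := by
    intro α hα
    simp only [anchors, Finset.mem_filter, Finset.mem_univ, true_and]
    rcases Finset.mem_union.mp hα with hα | hα
    · rcases Finset.mem_union.mp hα with hα | hα
      · have := card_of_mem_T11 hα; omega
      · have := card_of_mem_T21 hα; omega
    · have := card_of_mem_T12 hα; omega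
  rw [← Finset.prod_subset hsub, Finset.prod_union hd2, Finset.prod_union hd1]
  intro α hα hnot
  have hα' := Finset.mem_filter.mp hα
  apply starFactor_eq_one_of_cards
  · intro hc; exact hnot (Finset.mem_union_left _ (Finset.mem_union_left _ (mem_T11_of_cards hc.1 hc.2)))
  · intro hc; exact hnot (Finset.mem_union_left _ (Finset.mem_union_right _ (mem_T21_of_cards hc.1 hc.2)))
  · intro hc; exact hnot (Finset.mem_union_right _ (mem_T12_of_cards hc.1 hc.2))

/-! ## 3. The three families as iterated products -/

/-- The `(2,1)` factor as a function of `(b, a, d)`. -/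
def fx (g : Fin h → Fin h → ℂ) (b a d : Fin h) : MvPolynomial (Fin (h + h)) ℂ :=
  1 + (C (g a d) * xv a * yv d) * ((C (g b d) * xv b) * ∏ b' ∈ Finset.Iio b, (1 + C (g b' d) * xv b'))

/-- The `(1,2)` factor as a function of `(a, e, d)`. -/
def fy (dd : Fin h → Fin h → ℂ) (a e d : Fin h) : MvPolynomial (Fin (h + h)) ℂ :=
  1 + (C (dd a d) * xv a * yv d) * ((C (dd a e) * yv e) * ∏ e' ∈ Finset.Iio e, (1 + C (dd a e') * yv e'))

/-- The vertices below `a` form `Finset.Iio a`. -/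
theorem filter_lt_eq_Iio (a : Fin h) : Finset.univ.filter (fun b => b < a) = Finset.Iio a := by
  ext b; simp

/-- The product of the vertex star factors, as an iterated product over `d` and `a`. -/
theorem prod_T11 (g dd : Fin h → Fin h → ℂ) :
    ∏ α ∈ T11 h, starFactor g dd α = ∏ a : Fin h, ∏ d : Fin h, (1 + C (g a d + dd a d) * xv a * yv d) := by
  classical
  rw [T11, Finset.prod_image (fun p _ q _ hpq => vtx_injective hpq), Fintype.prod_prod_type]
  refine Finset.prod_congr rfl fun a _ => Finset.prod_congr rfl fun d _ => ?_
  exact starFactor_vtx g dd a d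

/-- The product of the `(2,1)` star factors, as an iterated product `∏_d ∏_a ∏_{b < a}`. -/
theorem prod_T21 (g dd : Fin h → Fin h → ℂ) :
    ∏ α ∈ T21 h, starFactor g dd α = ∏ d : Fin h, ∏ a : Fin h, ∏ b ∈ Finset.Iio a, fx g b a d := by
  classical
  rw [T21, Finset.prod_image T21_injOn, Finset.prod_filter, Fintype.prod_prod_type, Fintype.prod_prod_type]
  -- ∏_b ∏_a ∏_d (if b < a then F else 1)  →  ∏_d ∏_a ∏_{b < a} fx
  have hF : ∀ b a d : Fin h, (if ((b, a), d).1.1 < ((b, a), d).1.2 then starFactor g dd (({b, a}, {d}) : Finset (Fin h) × Finset (Fin h)) else 1) =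
      if b < a then fx g b a d else 1 := by
    intro b a d
    by_cases hba : b < a
    · simp only [hba, if_true]; exact starFactor_pair_left g dd hba d
    · simp only [hba, if_false]
  simp_rw [hF]
  rw [Finset.prod_comm]
  refine (Finset.prod_congr rfl fun a _ => ?_).trans Finset.prod_comm
  rw [Finset.prod_comm]
  refine Finset.prod_congr rfl fun d _ => ?_
  rw [← Finset.prod_filter, filter_lt_eq_Iio]

/-- The product of the `(1,2)` star factors, as an iterated product `∏_a ∏_d ∏_{e < d}`. -/
theorem prod_T12 (g dd : Fin h → Fin h → ℂ) :
    ∏ α ∈ T12 h, starFactor g dd α = ∏ a : Fin h, ∏ d : Fin h, ∏ e ∈ Finset.Iio d, fy dd a e d := by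
  classical
  rw [T12, Finset.prod_image T12_injOn, Finset.prod_filter, Fintype.prod_prod_type]
  refine Finset.prod_congr rfl fun a _ => ?_
  rw [Fintype.prod_prod_type]
  have hF : ∀ e d : Fin h, (if (a, (e, d)).2.1 < (a, (e, d)).2.2 then starFactor g dd (({a}, {e, d}) : Finset (Fin h) × Finset (Fin h)) else 1) =
      if e < d then fy dd a e d else 1 := by
    intro e d
    by_cases hed : e < d
    · simp only [hed, if_true]; exact starFactor_pair_right g dd a hed
    · simp only [hed, if_false]
  simp_rw [hF]
  rw [Finset.prod_comm]
  refine Finset.prod_congr rfl fun d _ => ?_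
  rw [← Finset.prod_filter, filter_lt_eq_Iio]

end StarDoor

end

end Summit.ValiantsHypothesis.ValiantsHypothesis.Theorems.BarrierLever.AnchoredPeeling
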